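import Literature.AlgebraicGeometry.AbelianSchemes.RigidifyAlongUnitSlice
import Literature.AlgebraicGeometry.AbelianSchemes.RigidifiedLineBundleTensor
import Literature.AlgebraicGeometry.AbelianSchemes.AbelianSchemeDualPairBaseChange
import HarnessLib

/-!
# Renormalising a dual pair along `A × {ε_Â}`: every dual pair `(Â, 𝒫)` is replaced by one with `𝒫|_{A × {ε_Â}} ≅ 𝒪`
# and the SAME dual abelian scheme `Â` (as a group scheme)

Layer `Literature/AlgebraicGeometry/AbelianSchemes`, namespace
`Literature.AlgebraicGeometry.AbelianSchemes.AbelianSchemeOver.DualPair`.  Cell hodgecm-mathlib (D-0151), hand (h7)(D-F3)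
(B-plan1 (g15) GO 06:07Z): the last binder of the (h7) chain — the «unit hypothesis»
`unit₀ : 𝒫₀|_{Z × {ε_Ẑ}} ≅ 𝒪` of ★ `AbelianSchemeDualTransport` §4 (and of ★ FILE A/A2/B/C/F) — holds for a suitable
dual pair whatever dual pair one starts from.  ONE definition-pair with body (`normalizeTwist`/`normalizeP`, modules, and
`normalize`, a `DualPair`); theorems otherwise; no instance, no notation, no `sorry`.

The abstract ★ `DualPair` `D = (Â, 𝒫)` of `A/S` ([MilneAV2008, I §8]) normalises `𝒫` along `{ε_A} × Â` only; the
group law of `Â` is not tied to `𝒫`, so `M := 𝒫|_{A × {ε_Â}}` (a rigidified fibrewise-`Pic⁰` line bundle on `A`,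
classified by the section `ε_Â`) need not be trivial (★ `RigidifiedLineBundleTensor`: «translating the group law of `hat`
by a section gives another dual pair»).  Dually to [MilneAV2008, I §8, proof of 8.4] / [MumfordFogartyKirwan1994, Ch. 6
§2 p. 121] (twist by the inverse of the pull-back of the restriction to a slice), put

  `D.normalize := (Â, 𝒫 ⊗ (pr_A^* M)^∨)`.

* §1 `IsHomogeneous.dual` (rank one) and the determinant class of the twisted sheaf:
  `[h^*(𝒫 ⊗ (pr_A^*M)^∨)] = h^*[𝒫] · ((h ≫ pr_A ≫ (A × {ε_Â}))^*[𝒫])⁻¹` (`detClass_pullback_normalizeP`);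
* §2 the three slices: `{ε_A} × Â` (`rigid_normalizeP`: still rigidified, since `ε_A^*M ≅ ε_Â^*(𝒫|_{{ε_A} × Â}) ≅ 𝒪`),
  **`A × {ε_Â}` (`nonempty_unitHatSlice_normalizeP_iso`: NOW TRIVIAL — `[M] · [M]⁻¹ = 1`)**, and the geometric slices
  `A_s × {b}` (`isHomogeneous_fibreSlice_normalizeP`: twisting by the translation-invariant `(M|_{A_s})^∨` — `M|_{A_s}` is the
  `𝒫`-slice at `s ≫ ε_Â`, ★ `isHomogeneous_pullback_sliceOver` — keeps clause (a), ★
  `isHomogeneous_tensorObj_iff_of_isHomogeneous_right`);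
* §3 universality: `(1_A × g)^*(𝒫 ⊗ (pr_A^*M)^∨) ≅ ℒ ⟺ (1_A × g)^*𝒫 ≅ ℒ ⊗ M_T` with `M_T := (1_A × (f ≫ ε_Â))^*𝒫` the
  (rigidified, fibrewise-`Pic⁰`, ★ `rigid_pullbackP`/`fibrewisePicZero_pullbackP`) restriction of `M` to `A_T`
  (`nonempty_pullback_normalizeP_iso_iff`, a determinant-class identity), so `∃!` transfers from `D` (★ `universal` applied
  to `ℒ ⊗ M_T`, ★ `rigid_tensorObj`/`fibrewisePicZero_tensorObj`);
* §4 **`D.normalize : A.DualPair`** with `normalize_hat : D.normalize.hat = D.hat` (`rfl`) and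
  **`nonempty_unitHatSlice_iso_normalize`** — the unit hypothesis holds for `D.normalize`.

All isomorphisms of rank-one modules come from identities in the commutative groups `Ȟ¹(·, 𝒪^×)` (★
`nonempty_iso_iff_detClass_eq`, `detClass_tensorObj_of_hasRank_one`, `detClass_dual'`, `detClass_pullback`,
`CechPic.pullback_comp`), exactly as in ★ `RigidifyAlongUnitSlice`.  HC_CM is proved only modulo the printed citations
until rung 0 closes; nothing here is about HC.

## References
* [MilneAV2008] J. S. Milne, *Abelian Varieties* (v2.00, 2008), I §8 pp. 36–37 (the dual pair; proof of 8.4: twisting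
  a family by the pull-back of its restriction to a slice).
* [MumfordFogartyKirwan1994] D. Mumford, J. Fogarty, F. Kirwan, *Geometric Invariant Theory*, 3rd ed. (1994), Ch. 6 §2
  (p. 121) (normalised Poincaré sheaf), Ch. 6 §1 Cor. 6.8 (p. 118).
* [MumfordAV1970] D. Mumford, *Abelian Varieties* (1970), §8 ((iv) ⇔ (i)), §13 (p. 125).
* [Hartshorne1977] R. Hartshorne, *Algebraic Geometry* (1977), II Prop. 6.12, II Ex. 6.11.
-/

noncomputable section

-- `Scheme.Modules` / the `Over`-monoidal carriers are not reducible: `(A.baseChange f).X.left = pullback A.X.hom f` holds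
-- by `rfl` only (as in ★ `RigidifyAlongUnitSlice` and Mathlib's `AlgebraicGeometry/Modules`).
set_option backward.isDefEq.respectTransparency false

universe u

open CategoryTheory CategoryTheory.Limits AlgebraicGeometry MonoidalCategory

/-! ### §1a The dual of a translation-invariant line bundle is translation invariant -/

namespace Literature.AlgebraicGeometry.AbelianVarieties

open Literature.AlgebraicGeometry.Motives Literature.AlgebraicGeometry.Modules

/-- **The dual of a translation-invariant line bundle is translation invariant**: `t_x^*[F^∨] = (t_x^*[F])⁻¹ = [F]⁻¹ = [F^∨]`
in `Ȟ¹(A, 𝒪^×)` (★ `isHomogeneous_iff_forall_pullback_detClass_eq`, ★ `detClass_dual'`). [cite: MumfordAV1970, §8 ((iv) ⇔ (i))]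
[cite: Hartshorne1977, II Ex. 6.11] -/
theorem IsHomogeneous.dual {K : Type u} [Field K] (A : AbelianVariety K) {F : A.X.left.Modules} (hF : HasRank F 1)
    (h : IsHomogeneous A F) : IsHomogeneous A (Modules.dual F) := by
  have hF₁ := HasRank.isFiniteLocallyFree' hF
  have hD₁ := HasRank.isFiniteLocallyFree' (hasRank_dual hF)
  rw [isHomogeneous_iff_forall_pullback_detClass_eq A hF hF₁] at h
  rw [isHomogeneous_iff_forall_pullback_detClass_eq A (hasRank_dual hF) hD₁]
  intro P
  rw [detClass_dual' hF₁ hD₁, map_inv, h P]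

end Literature.AlgebraicGeometry.AbelianVarieties

namespace Literature.AlgebraicGeometry.AbelianSchemes

namespace AbelianSchemeOver

open Literature.AlgebraicGeometry.Motives Literature.AlgebraicGeometry.AbelianVarieties
  Literature.AlgebraicGeometry.Modules

variable {S : Scheme.{u}} {A : AbelianSchemeOver S}

namespace DualPair

variable (D : A.DualPair)

/-! ### §1b The twist `(pr_A^* (𝒫|_{A × {ε_Â}}))^∨` and the class of the twisted Poincaré sheaf -/

/-- **The twisting module `(pr_A^* M)^∨` on `A ×_S Â`, `M := 𝒫|_{A × {ε_Â}} = (A × {ε_Â})^*𝒫`** (★ `unitHatSlice`).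
[cite: MilneAV2008, I §8 pp. 36–37] [cite: MumfordFogartyKirwan1994, Ch. 6 §2 (p. 121)] -/
def normalizeTwist : (A.prodLeft D.hat).Modules :=
  Modules.dual ((Scheme.Modules.pullback (pullback.fst A.X.hom D.hat.X.hom)).obj
    ((Scheme.Modules.pullback (unitHatSlice D)).obj D.P))

/-- **The renormalised Poincaré sheaf `𝒫 ⊗ (pr_A^* M)^∨`.** [cite: MilneAV2008, I §8 pp. 36–37]
[cite: MumfordFogartyKirwan1994, Ch. 6 §2 (p. 121)] -/
def normalizeP : (A.prodLeft D.hat).Modules :=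
  tensorObj D.P D.normalizeTwist

/-- The twist has rank one. [cite: Hartshorne1977, II Prop. 6.12] -/
theorem hasRank_normalizeTwist : HasRank D.normalizeTwist 1 :=
  hasRank_dual (hasRank_pullback _ (hasRank_pullback _ D.hasRank_one))

/-- The renormalised Poincaré sheaf is a line bundle. [cite: Hartshorne1977, II Prop. 6.12] -/
theorem hasRank_normalizeP : HasRank D.normalizeP 1 :=
  hasRank_tensorObj_one D.hasRank_one D.hasRank_normalizeTwist

/-- The class of the twist: `[(pr_A^* M)^∨] = (pr_A^* (A × {ε_Â})^* [𝒫])⁻¹`. [cite: Hartshorne1977, II Ex. 6.11] -/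
theorem detClass_normalizeTwist (h : IsFiniteLocallyFree D.normalizeTwist) :
    detClass h = (CechPic.pullback (pullback.fst A.X.hom D.hat.X.hom)
      (CechPic.pullback (unitHatSlice D) (detClass (HasRank.isFiniteLocallyFree' D.hasRank_one))))⁻¹ := by
  have hP₁ := HasRank.isFiniteLocallyFree' D.hasRank_one
  have e1 : detClass h =
      (detClass ((hP₁.pullback (unitHatSlice D)).pullback (pullback.fst A.X.hom D.hat.X.hom)))⁻¹ :=
    detClass_dual' ((hP₁.pullback (unitHatSlice D)).pullback (pullback.fst A.X.hom D.hat.X.hom)) h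
  rw [e1, detClass_pullback (hE := hP₁.pullback (unitHatSlice D)), detClass_pullback (hE := hP₁)]

/-- The class of the renormalised sheaf: `[𝒫 ⊗ (pr_A^*M)^∨] = [𝒫] · (pr_A^* (A × {ε_Â})^* [𝒫])⁻¹`.
[cite: Hartshorne1977, II Ex. 6.11] -/
theorem detClass_normalizeP (h : IsFiniteLocallyFree D.normalizeP) :
    detClass h = detClass (HasRank.isFiniteLocallyFree' D.hasRank_one) *
      (CechPic.pullback (pullback.fst A.X.hom D.hat.X.hom)
        (CechPic.pullback (unitHatSlice D) (detClass (HasRank.isFiniteLocallyFree' D.hasRank_one))))⁻¹ := by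
  have hT₁ := HasRank.isFiniteLocallyFree' D.hasRank_normalizeTwist
  rw [← D.detClass_normalizeTwist hT₁]
  exact detClass_tensorObj_of_hasRank_one D.hasRank_one D.hasRank_normalizeTwist _ hT₁ h

/-- **The class of the renormalised sheaf after any `h : X → A ×_S Â`**:
`[h^*(𝒫 ⊗ (pr_A^*M)^∨)] = h^*[𝒫] · ((h ≫ pr_A ≫ (A × {ε_Â}))^*[𝒫])⁻¹` (★ `CechPic.pullback_comp`).
[cite: Hartshorne1977, II Ex. 6.11] [cite: MilneAV2008, I §8 pp. 36–37] -/
theorem detClass_pullback_normalizeP {X : Scheme.{u}} (h : X ⟶ A.prodLeft D.hat)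
    (hX : IsFiniteLocallyFree ((Scheme.Modules.pullback h).obj D.normalizeP)) :
    detClass hX = CechPic.pullback h (detClass (HasRank.isFiniteLocallyFree' D.hasRank_one)) *
      (CechPic.pullback (h ≫ pullback.fst A.X.hom D.hat.X.hom ≫ unitHatSlice D)
        (detClass (HasRank.isFiniteLocallyFree' D.hasRank_one)))⁻¹ := by
  have hN₁ := HasRank.isFiniteLocallyFree' D.hasRank_normalizeP
  rw [detClass_congr hX (hN₁.pullback h), detClass_pullback (hE := hN₁), D.detClass_normalizeP hN₁, map_mul, map_inv,
    ← CechPic.pullback_comp, ← CechPic.pullback_comp, Category.assoc]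

/-! ### §2 The three slices of the renormalised sheaf -/

/-- `ε_A ≫ (A × {ε_Â}) = ε_Â ≫ ({ε_A} × Â)`: both are `(ε_A, ε_Â) : S → A ×_S Â`. [cite: MilneAV2008, I §8 pp. 36–37] -/
theorem unitSection_comp_unitHatSlice :
    A.unitSection ≫ unitHatSlice D = D.hat.unitSection ≫ A.unitSlice D.hat := by
  apply pullback.hom_ext
  · rw [Category.assoc, unitHatSlice_fst, Category.comp_id, Category.assoc, unitSlice_fst, ← Category.assoc,
      D.hat.unitSection_comp_hom, Category.id_comp]
  · rw [Category.assoc, unitHatSlice_snd, ← Category.assoc, A.unitSection_comp_hom, Category.id_comp, Category.assoc,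
      unitSlice_snd, Category.comp_id]

/-- `({ε_A} × Â) ≫ pr_A ≫ (A × {ε_Â}) = π̂ ≫ ε_Â ≫ ({ε_A} × Â)`. [cite: MilneAV2008, I §8 pp. 36–37] -/
theorem unitSlice_comp_fst_comp_unitHatSlice :
    A.unitSlice D.hat ≫ pullback.fst A.X.hom D.hat.X.hom ≫ unitHatSlice D =
      D.hat.X.hom ≫ D.hat.unitSection ≫ A.unitSlice D.hat := by
  rw [← Category.assoc, unitSlice_fst, Category.assoc, unitSection_comp_unitHatSlice]

/-- `[𝒫]` dies on `{ε_A} × Â` (clause (b) `rigid` of the dual pair, read on classes). [cite: MumfordFogartyKirwan1994, Ch. 6 §2 (p. 121)] -/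
theorem cechPic_pullback_unitSlice_detClass_eq_one :
    CechPic.pullback (A.unitSlice D.hat) (detClass (HasRank.isFiniteLocallyFree' D.hasRank_one)) = 1 := by
  have hP₁ := HasRank.isFiniteLocallyFree' D.hasRank_one
  obtain ⟨r⟩ := D.rigid
  rw [← detClass_pullback (hE := hP₁), detClass_eq_of_iso r (hP₁.pullback _)
    (HasRank.isFiniteLocallyFree' hasRank_unitModule)]
  exact detClass_unitModule_eq_one _

/-- **Clause (b) survives: the renormalised sheaf is still rigidified along `{ε_A} × Â`** — its class there is
`({ε_A} × Â)^*[𝒫] · (π̂^* ε_Â^* ({ε_A} × Â)^*[𝒫])⁻¹ = 1 · 1⁻¹`. [cite: MumfordFogartyKirwan1994, Ch. 6 §2 (p. 121)]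
[cite: MilneAV2008, I §8 pp. 36–37] -/
theorem rigid_normalizeP :
    Nonempty ((Scheme.Modules.pullback (A.unitSlice D.hat)).obj D.normalizeP ≅ SheafOfModules.unit _) := by
  have hN := D.hasRank_normalizeP
  have hN₁ := HasRank.isFiniteLocallyFree' hN
  refine nonempty_iso_unitModule_of_detClass_eq_one (hasRank_pullback _ hN) (hN₁.pullback _) ?_
  rw [D.detClass_pullback_normalizeP (A.unitSlice D.hat) (hN₁.pullback _), D.unitSlice_comp_fst_comp_unitHatSlice,
    CechPic.pullback_comp, CechPic.pullback_comp, D.cechPic_pullback_unitSlice_detClass_eq_one, map_one, map_one, inv_one,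
    mul_one]

/-- **THE POINT: the renormalised sheaf is trivial on `A × {ε_Â}`** — `(A × {ε_Â}) ≫ pr_A = 𝟙`, so its class there is
`[M] · [M]⁻¹ = 1`. [cite: MilneAV2008, I §8 pp. 36–37] [cite: MumfordFogartyKirwan1994, Ch. 6 §2 (p. 121)] -/
theorem nonempty_unitHatSlice_normalizeP_iso :
    Nonempty ((Scheme.Modules.pullback (unitHatSlice D)).obj D.normalizeP ≅ SheafOfModules.unit _) := by
  have hN := D.hasRank_normalizeP
  have hN₁ := HasRank.isFiniteLocallyFree' hN
  refine nonempty_iso_unitModule_of_detClass_eq_one (hasRank_pullback _ hN) (hN₁.pullback _) ?_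
  have hc : unitHatSlice D ≫ pullback.fst A.X.hom D.hat.X.hom ≫ unitHatSlice D = unitHatSlice D := by
    rw [← Category.assoc, unitHatSlice_fst, Category.id_comp]
  rw [D.detClass_pullback_normalizeP (unitHatSlice D) (hN₁.pullback _), hc, mul_inv_cancel]

/-- The fibre inclusion followed by `A × {ε_Â}` is the slice over `s` at the point `s ≫ ε_Â` (★ `sliceOver`): both are
`(pr_A, pr ≫ s ≫ ε_Â)`. [cite: MilneAV2008, I §8 pp. 36–37] -/
theorem fst_comp_unitHatSlice_eq_sliceOver {Ω : Type u} [Field Ω] (s : Spec (.of Ω) ⟶ S) :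
    pullback.fst A.X.hom s ≫ unitHatSlice D =
      D.sliceOver (s ≫ D.hat.unitSection) s
        ((Category.assoc _ _ _).trans ((congrArg (s ≫ ·) D.hat.unitSection_comp_hom).trans (Category.comp_id s))) := by
  apply pullback.hom_ext
  · rw [Category.assoc, unitHatSlice_fst, Category.comp_id, sliceOver_fst]
  · rw [Category.assoc, unitHatSlice_snd, sliceOver_snd, ← Category.assoc, pullback.condition, Category.assoc]

/-- **Clause (a) survives: the geometric slices of the renormalised sheaf are translation invariant** — the slice at a
geometric point `b` of `Â` (base point `s`) is `𝒫|_{A_s × {b}} ⊗ (M|_{A_s})^∨` with `M|_{A_s} = 𝒫|_{A_s × {ε_Â(s)}}`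
translation invariant (★ `isHomogeneous_pullback_sliceOver`), so on classes `t_x^*([𝒫_b] · [M|_{A_s}]⁻¹) = [𝒫_b] · [M|_{A_s}]⁻¹`
(★ `isHomogeneous_iff_forall_pullback_detClass_eq`). [cite: MumfordAV1970, §8 ((iv) ⇔ (i))]
[cite: MilneAV2008, I §8 pp. 36–37] -/
theorem isHomogeneous_fibreSlice_normalizeP (Ω : Type u) [Field Ω] [IsAlgClosed Ω] (b : Spec (.of Ω) ⟶ D.hat.X.left) :
    IsHomogeneous (A.fibre (b ≫ D.hat.X.hom)).toAbelianVariety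
      ((Scheme.Modules.pullback (A.fibreSlice D.hat b)).obj D.normalizeP) := by
  have hP := D.hasRank_one
  have hP₁ := HasRank.isFiniteLocallyFree' hP
  have hN := D.hasRank_normalizeP
  have hN₁ := HasRank.isFiniteLocallyFree' hN
  have hs : (b ≫ D.hat.X.hom) ≫ D.hat.unitSection ≫ D.hat.X.hom = b ≫ D.hat.X.hom :=
    (congrArg ((b ≫ D.hat.X.hom) ≫ ·) D.hat.unitSection_comp_hom).trans (Category.comp_id _)
  -- the slice followed by `pr_A ≫ (A × {ε_Â})` is the slice over `s` at `s ≫ ε_Â`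
  have hE : A.fibreSlice D.hat b ≫ pullback.fst A.X.hom D.hat.X.hom ≫ unitHatSlice D =
      D.sliceOver ((b ≫ D.hat.X.hom) ≫ D.hat.unitSection) (b ≫ D.hat.X.hom)
        ((Category.assoc _ _ _).trans hs) :=
    (Category.assoc _ _ _).symm.trans ((congrArg (· ≫ unitHatSlice D) (A.fibreSlice_fst D.hat b)).trans
      (D.fst_comp_unitHatSlice_eq_sliceOver (b ≫ D.hat.X.hom)))
  -- classes: `t^*` fixes the slice class of `𝒫` (clause (a)) and the class of `M|_{A_s}` (clause (a) at `s ≫ ε_Â`)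
  have ha := (isHomogeneous_iff_forall_pullback_detClass_eq (A.fibre (b ≫ D.hat.X.hom)).toAbelianVariety
    (hasRank_pullback (A.fibreSlice D.hat b) hP) (hP₁.pullback (A.fibreSlice D.hat b))).1 (D.fibrewisePicZero Ω b)
  have hb := (isHomogeneous_iff_forall_pullback_detClass_eq (A.fibre (b ≫ D.hat.X.hom)).toAbelianVariety
    (hasRank_pullback (D.sliceOver ((b ≫ D.hat.X.hom) ≫ D.hat.unitSection) (b ≫ D.hat.X.hom)
      ((Category.assoc _ _ _).trans hs)) hP)
    (hP₁.pullback (D.sliceOver ((b ≫ D.hat.X.hom) ≫ D.hat.unitSection) (b ≫ D.hat.X.hom)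
      ((Category.assoc _ _ _).trans hs)))).1 (D.isHomogeneous_pullback_sliceOver _ ((Category.assoc _ _ _).trans hs))
  rw [isHomogeneous_iff_forall_pullback_detClass_eq (A.fibre (b ≫ D.hat.X.hom)).toAbelianVariety
    (hasRank_pullback (A.fibreSlice D.hat b) hN) (hN₁.pullback (A.fibreSlice D.hat b))]
  intro P
  have ha' := ha P
  have hb' := hb P
  rw [detClass_pullback (hE := hP₁)] at ha' hb'
  rw [D.detClass_pullback_normalizeP _ (hN₁.pullback _), hE, map_mul, map_inv, ha', hb']

/-! ### §3 Universality transfers: `(1 × g)^*(𝒫 ⊗ (pr_A^*M)^∨) ≅ ℒ ⟺ (1 × g)^*𝒫 ≅ ℒ ⊗ M_T` -/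

section Universal

variable {T : Scheme.{u}} (f : T ⟶ S)

/-- The section `T → S → Â` through `ε_Â` lies over `f`. [cite: MilneAV2008, I §8 pp. 36–37] -/
theorem comp_unitSection_comp_hom : (f ≫ D.hat.unitSection) ≫ D.hat.X.hom = f :=
  (Category.assoc _ _ _).trans ((congrArg (f ≫ ·) D.hat.unitSection_comp_hom).trans (Category.comp_id f))

/-- **`M_T := (1_A × (f ≫ ε_Â))^*𝒫`, the restriction of `M` to `A_T`, as a rigidified family** (★ `rigid_pullbackP`).
[cite: MilneAV2008, I §8 pp. 36–37] -/
def unitHatFamily : A.RigidifiedLineBundle f :=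
  ⟨D.pullbackP f (f ≫ D.hat.unitSection) (D.comp_unitSection_comp_hom f),
    D.hasRank_one_pullbackP f _ _, D.rigid_pullbackP f _ _⟩

/-- The module of `M_T` (definitional). [cite: MilneAV2008, I §8 pp. 36–37] -/
theorem unitHatFamily_L :
    (D.unitHatFamily f).L = D.pullbackP f (f ≫ D.hat.unitSection) (D.comp_unitSection_comp_hom f) := rfl

/-- `M_T` lies fibrewise in `Pic⁰` (★ `fibrewisePicZero_pullbackP`). [cite: MumfordAV1970, §8 ((iv) ⇔ (i))] -/
theorem unitHatFamily_fibrewisePicZero : (D.unitHatFamily f).FibrewisePicZero :=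
  D.fibrewisePicZero_pullbackP f _ _

/-- `(1_A × g) ≫ pr_A ≫ (A × {ε_Â}) = 1_A × (f ≫ ε_Â)` for any `g` over `f` (both are `(pr_A, pr_T ≫ f ≫ ε_Â)`).
[cite: MilneAV2008, I §8 pp. 36–37] -/
theorem baseChangeToProd_comp_fst_comp_unitHatSlice (g : T ⟶ D.hat.X.left) (hg : g ≫ D.hat.X.hom = f) :
    A.baseChangeToProd D.hat f g hg ≫ pullback.fst A.X.hom D.hat.X.hom ≫ unitHatSlice D =
      A.baseChangeToProd D.hat f (f ≫ D.hat.unitSection) (D.comp_unitSection_comp_hom f) := by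
  apply pullback.hom_ext
  · rw [Category.assoc, Category.assoc, unitHatSlice_fst, Category.comp_id, baseChangeToProd_fst, baseChangeToProd_fst]
  · rw [Category.assoc, Category.assoc, unitHatSlice_snd, baseChangeToProd_fst_assoc, baseChangeToProd_snd,
      ← Category.assoc, pullback.condition, Category.assoc]

/-- **The transfer identity**: for `g` over `f` and a line bundle `L` on `A_T`,
`(1_A × g)^*(𝒫 ⊗ (pr_A^*M)^∨) ≅ L ⟺ (1_A × g)^*𝒫 ≅ L ⊗ M_T` — on classes, `a · m⁻¹ = l ⟺ a = l · m`.
[cite: MilneAV2008, I §8 pp. 36–37] [cite: Hartshorne1977, II Ex. 6.11] -/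
theorem nonempty_pullback_normalizeP_iso_iff (g : T ⟶ D.hat.X.left) (hg : g ≫ D.hat.X.hom = f)
    {L : (A.baseChange f).X.left.Modules} (hL : HasRank L 1) :
    Nonempty ((Scheme.Modules.pullback (A.baseChangeToProd D.hat f g hg)).obj D.normalizeP ≅ L) ↔
      Nonempty ((Scheme.Modules.pullback (A.baseChangeToProd D.hat f g hg)).obj D.P ≅
        tensorObj L (D.unitHatFamily f).L) := by
  have hP := D.hasRank_one
  have hP₁ := HasRank.isFiniteLocallyFree' hP
  have hN := D.hasRank_normalizeP
  have hN₁ := HasRank.isFiniteLocallyFree' hN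
  have hL₁ := HasRank.isFiniteLocallyFree' hL
  have hM : HasRank (D.unitHatFamily f).L 1 := (D.unitHatFamily f).hasRank_one
  have hM₁ := HasRank.isFiniteLocallyFree' hM
  have hLM₁ := isFiniteLocallyFree_tensorObj _ _ hL₁ hM₁
  refine (nonempty_iso_iff_detClass_eq (hasRank_pullback _ hN) hL (hN₁.pullback _) hL₁).trans
    (Iff.trans ?_ (nonempty_iso_iff_detClass_eq (hasRank_pullback _ hP) (hasRank_tensorObj_one hL hM)
      (hP₁.pullback _) hLM₁).symm)
  have hm : detClass hM₁ = CechPic.pullback (A.baseChangeToProd D.hat f (f ≫ D.hat.unitSection)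
      (D.comp_unitSection_comp_hom f)) (detClass hP₁) :=
    (detClass_congr hM₁ (hP₁.pullback _)).trans (detClass_pullback _ hP₁)
  rw [D.detClass_pullback_normalizeP _ (hN₁.pullback _), D.baseChangeToProd_comp_fst_comp_unitHatSlice f g hg,
    detClass_tensorObj_of_hasRank_one hL hM hL₁ hM₁ hLM₁, detClass_pullback (hE := hP₁), hm]
  exact mul_inv_eq_iff_eq_mul

/-- **UNIVERSALITY of the renormalised pair**: every rigidified fibrewise-`Pic⁰` `ℒ` on `A_T` is
`(1_A × g)^*(𝒫 ⊗ (pr_A^*M)^∨)` for a unique `g` over `f` — apply ★ `universal` of `D` to `ℒ ⊗ M_T` (rigidified and fibrewise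
in `Pic⁰`: ★ `rigid_tensorObj`, ★ `fibrewisePicZero_tensorObj`) and transfer (§3 identity). [cite: MilneAV2008, I §8 pp. 36–37]
[cite: MumfordFogartyKirwan1994, Ch. 6 §1 Cor. 6.8 (p. 118)] -/
theorem universal_normalizeP (ℒ : A.RigidifiedLineBundle f) (hℒ : ℒ.FibrewisePicZero) :
    ∃! g : {g : T ⟶ D.hat.X.left // g ≫ D.hat.X.hom = f},
      Nonempty ((Scheme.Modules.pullback (A.baseChangeToProd D.hat f g.1 g.2)).obj D.normalizeP ≅ ℒ.L) := by
  let ℒ' : A.RigidifiedLineBundle f :=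
    ⟨tensorObj ℒ.L (D.unitHatFamily f).L, RigidifiedLineBundle.hasRank_one_tensorObj ℒ (D.unitHatFamily f),
      RigidifiedLineBundle.rigid_tensorObj ℒ (D.unitHatFamily f)⟩
  have hℒ' : ℒ'.FibrewisePicZero :=
    RigidifiedLineBundle.fibrewisePicZero_tensorObj ℒ (D.unitHatFamily f) hℒ (D.unitHatFamily_fibrewisePicZero f)
  obtain ⟨⟨g, hg⟩, hgP, huniq⟩ := D.universal f ℒ' hℒ'
  refine ⟨⟨g, hg⟩, (D.nonempty_pullback_normalizeP_iso_iff f g hg ℒ.hasRank_one).2 hgP, fun g' h' => ?_⟩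
  exact huniq g' ((D.nonempty_pullback_normalizeP_iso_iff f g'.1 g'.2 ℒ.hasRank_one).1 h')

end Universal

/-! ### §4 The renormalised dual pair -/

/-- **THE RENORMALISED DUAL PAIR `D.normalize = (Â, 𝒫 ⊗ (pr_A^* (𝒫|_{A × {ε_Â}}))^∨)`** — the same dual abelian scheme
`Â` (with its group law), the Poincaré sheaf twisted so that it becomes trivial on `A × {ε_Â}` as well
([MumfordFogartyKirwan1994, Ch. 6 §2 p. 121]: the normalised Poincaré sheaf; [MilneAV2008, I §8]).  Rank one (§1),
rigidified along `{ε_A} × Â` and fibrewise in `Pic⁰` (§2), universal (§3). [cite: MilneAV2008, I §8 pp. 36–37]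
[cite: MumfordFogartyKirwan1994, Ch. 6 §2 (p. 121)] -/
def normalize : A.DualPair where
  hat := D.hat
  P := D.normalizeP
  hasRank_one := D.hasRank_normalizeP
  rigid := D.rigid_normalizeP
  fibrewisePicZero := D.isHomogeneous_fibreSlice_normalizeP
  universal := fun f ℒ hℒ => D.universal_normalizeP f ℒ hℒ

/-- The dual abelian scheme of `D.normalize` is `Â` (definitional). [cite: MilneAV2008, I §8 pp. 36–37] -/
theorem normalize_hat : D.normalize.hat = D.hat := rfl

/-- The Poincaré sheaf of `D.normalize` is the renormalised sheaf (definitional). [cite: MumfordFogartyKirwan1994, Ch. 6 §2 (p. 121)] -/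
theorem normalize_P : D.normalize.P = D.normalizeP := rfl

/-- **THE UNIT HYPOTHESIS HOLDS FOR `D.normalize`**: `𝒫'|_{A × {ε_Â}} ≅ 𝒪` — the binder `hD`/`unit₀` of ★
`AbelianSchemeDualTransport` §4, ★ `AbelianSchemeDualTransportOfBaseChange(AnyBase)`, ★
`AbelianSchemeOverZariskiGluingPolarizationOfDualPairs` and ★ `AbelianSchemeOverGlueDataPolarization(OfReduced)` is
discharged by passing from any dual pair `D₀` of the glued family to `D₀.normalize`. [cite: MilneAV2008, I §8 pp. 36–37]
[cite: MumfordFogartyKirwan1994, Ch. 6 §2 (p. 121)] -/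
theorem nonempty_unitHatSlice_iso_normalize :
    Nonempty ((Scheme.Modules.pullback (unitHatSlice D.normalize)).obj D.normalize.P ≅ SheafOfModules.unit _) :=
  D.nonempty_unitHatSlice_normalizeP_iso

end DualPair

end AbelianSchemeOver

end Literature.AlgebraicGeometry.AbelianSchemes

end
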